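import Mathlib
import Summits.Ventures.DiscreteObjects.Mahler.SmythIsolationCaseAExact
import Summits.Ventures.DiscreteObjects.Mahler.SmythIsolationCaseB

/-!
# Smyth's theorem: `θ₀` is isolated (venture `DiscreteObjects`, target L)

Cell `pub-namedobj`, seat `pub-namedobj-mahler` (gen 9). Framing: lottery ticket; floor = certified
bounds/negative ranges.

**Theorem** (Smyth 1971; [McKee–Smyth, *Around the Unit Circle*, Thm 12.1, last part]).  Let `P ∈ ℤ[X]`
be irreducible, `P(0) ≠ 0`, and neither reciprocal nor antireciprocal.  Then either
`M(P) = θ₀ = 1.3247…` or `M(P) ≥ √((93+√2249)/80) = 1.32487…` — the constant printed in Thm 12.1 —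
(`intMahlerMeasure_eq_smythTheta_or_ge`); in particular `θ₀ = M(z³ - z - 1)` is an ISOLATED point of the
set of Mahler measures of nonreciprocal irreducible integer polynomials (decimal corollaries
`intMahlerMeasure_eq_smythTheta_or_ge_13248`, `intMahlerMeasure_eq_smythTheta_of_lt`,
`intMahlerMeasure_ge_of_ne_smythTheta`).  (The book states the second alternative with strict inequality,
using in addition that a Mahler measure is an algebraic integer (Prop. 1.9); the kernel's case `ℓ < 2k`
gives `√((93+√2249)/80) ≤ M` (`SmythIsolationCaseAExact`), the case `ℓ ≥ 2k` gives `1.325 ≤ M`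
(`SmythIsolationCaseB`).)

Assembly (§12.2.1 reductions as in `SmythTheorem`): `c = 1/M < 3/4` means `M > 4/3`; else `a, b = ±1`;
`ℓ < 2k`: `smyth_analytic_caseA_exact`; `ℓ > 2k`: `smyth_isolation_caseB`; `ℓ = 2k`: `b = -1` is
impossible and for `b = 1` the polynomial `P' = εP*` (same measure, `P'* = εP`) satisfies
`εP' = P'*(1 - aX^k) + O(X^{2k+1})`, so `smyth_isolation_caseB` applies to `P'` (its degenerate
alternative gives `P ∣ P*·Q₀(-aX^k)`, hence `M(P) ≤ θ₀`, by irreducibility of `P`).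

* `smyth_isolation_of_monic` — monic core;
* `intMahlerMeasure_eq_smythTheta_or_ge` — the theorem; corollaries `…_of_lt`, `…_of_ne_smythTheta`.
-/

namespace Summit.Ventures.DiscreteObjects.Mahler

open Polynomial Metric Set Filter Topology Finset
open scoped ComplexConjugate

noncomputable section

/-! ### The theorem for monic `P` -/

/-- **Isolation of `θ₀`, monic core.**  `P` monic irreducible, `P(0) = ε = ±1`, `P* ≠ εP`, `M(P) > 1`:
`M(P) = θ₀` or `M(P) ≥ √((93+√2249)/80)`. -/
theorem smyth_isolation_of_monic {P : ℤ[X]} (hmonic : P.Monic) (hirr : Irreducible P) {ε : ℤ}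
    (hε : P.coeff 0 = ε) (hε1 : ε * ε = 1) (hne : P.reverse ≠ C ε * P) (hM1 : 1 < intMahlerMeasure P) :
    intMahlerMeasure P = smythTheta ∨ Real.sqrt ((93 + Real.sqrt 2249) / 80) ≤ intMahlerMeasure P := by
  set M := intMahlerMeasure P with hM
  have hMpos : 0 < M := lt_trans one_pos hM1
  obtain ⟨-, hK2⟩ := sqrt_smyth_gap_const_bounds
  obtain ⟨k, ℓ, a, b, R, hk, hkl, ha, hb, hid⟩ := exists_second_nonpalindromic_coeff hmonic hε hε1 hne
  obtain ⟨f, g, c, D, hcM, hfg⟩ := exists_smythData hmonic hε hε1 hM1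
  have hrel := smyth_relations_re hmonic hid D hfg
  by_cases hc : c < 3 / 4
  · right
    have h1 : M⁻¹ < 3 / 4 := hcM ▸ hc
    rw [inv_lt_comm₀ hMpos (by norm_num)] at h1
    norm_num at h1
    linarith
  push Not at hc
  have hrelk : (jetCoeff f k).re = (jetCoeff g k).re + a * c := by
    have h := hrel k hkl.le
    rw [if_pos le_rfl, if_neg (by omega), Nat.sub_self, D.symm.re_f0] at h
    linarith
  obtain ⟨ha1, -, -⟩ := smyth_orderK hc (D.abs_re_le hk) (D.symm.abs_re_le hk) ha hrelk
  have hrell : (jetCoeff f ℓ).re = (jetCoeff g ℓ).re + a * (jetCoeff g (ℓ - k)).re + b * c := by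
    have h := hrel ℓ le_rfl
    rw [if_pos hkl.le, if_pos rfl] at h
    exact h
  have hb1 : b = 1 ∨ b = -1 :=
    smyth_b_bound hc ha1 (D.abs_re_le (n := ℓ) (by omega)) (D.symm.abs_re_le (n := ℓ) (by omega))
      (D.symm.abs_re_le (n := ℓ - k) (by omega)) hb hrell
  have haa : a * a = 1 := by rcases ha1 with h | h <;> subst h <;> norm_num
  have hCa : C a * C a = (1 : ℤ[X]) := by rw [← map_mul, haa, map_one]
  have hCε : C ε * C ε = (1 : ℤ[X]) := by rw [← map_mul, hε1, map_one]
  rcases Nat.lt_trichotomy ℓ (2 * k) with hlt | heq | hgt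
  · -- case `ℓ < 2k`: (12.13)
    right
    have hc' := smyth_analytic_caseA_exact D hk hkl hlt ha hb hrel
    rwa [hcM, inv_inv] at hc'
  · -- case `ℓ = 2k`
    subst heq
    rw [show 2 * k - k = k by omega] at hrell
    rcases hb1 with hb1 | hb1
    · -- `b = 1`: pass to `P' = ε P*`, whose identity has no `z^{2k}` term
      subst hb1
      rw [map_one, one_mul] at hid
      set P' : ℤ[X] := C ε * P.reverse with hP'
      have hε0 : ε ≠ 0 := by rintro rfl; simp at hε1
      have htr : P.natTrailingDegree = 0 :=
        natTrailingDegree_eq_zero_of_constantCoeff_ne_zero (by rw [constantCoeff_apply, hε]; exact hε0)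
      have hrevrev : P.reverse.reverse = P := by
        have hd : P.reverse.natDegree = P.natDegree := by rw [reverse_natDegree, htr, Nat.sub_zero]
        rw [reverse, hd, reverse, reflect_reflect]
      have hmonic' : P'.Monic := by
        rw [Monic, hP', leadingCoeff_mul, leadingCoeff_C, reverse_leadingCoeff, trailingCoeff, htr, hε, hε1]
      have hε' : P'.coeff 0 = ε := by
        rw [hP', coeff_C_mul, coeff_zero_reverse, hmonic.leadingCoeff, mul_one]
      have hrev' : P'.reverse = C ε * P := by
        rw [hP', reverse_mul_of_domain, reverse_C, hrevrev]
      have hM' : intMahlerMeasure P' = M := by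
        have : P' = P.reverse ∨ P' = -P.reverse := by
          rcases Int.mul_eq_one_iff_eq_one_or_neg_one.mp hε1 with ⟨h, -⟩ | ⟨h, -⟩
          · left; rw [hP', h, map_one, one_mul]
          · right; rw [hP', h, map_neg, map_one, neg_one_mul]
        rcases this with h | h
        · rw [h, intMahlerMeasure_reverse_of_monic hmonic]
        · rw [h, intMahlerMeasure_neg, intMahlerMeasure_reverse_of_monic hmonic]
      have hM1' : 1 < intMahlerMeasure P' := by rw [hM']; exact hM1
      -- the identity for `P'`: `εP' = P'* (1 - aX^k) + X^{2k+1} R'`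
      have hS : X * (P.reverse - 1).divX = P.reverse - 1 := by
        have h := (P.reverse - 1).divX_mul_X_add
        rw [coeff_sub, coeff_zero_reverse, hmonic.leadingCoeff, coeff_one_zero, sub_self, map_zero,
          add_zero, mul_comm] at h
        exact h
      obtain ⟨k', rfl⟩ : ∃ k', k = k' + 1 := ⟨k - 1, by omega⟩
      have hid2 : C ε * P' = P'.reverse * (1 + C (-a) * X ^ (k' + 1)) +
          X ^ (2 * (k' + 1) + 1) * ((P.reverse - 1).divX + C a * X ^ k' - R * (1 - C a * X ^ (k' + 1))) := by
        rw [hrev', hP', map_neg]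
        linear_combination (-(1 - C a * X ^ (k' + 1))) * hid - X ^ (2 * (k' + 1)) * hS +
          P.reverse * hCε + (P.reverse * X ^ (2 * (k' + 1))) * hCa
      have ha1' : (-a) = 1 ∨ (-a) = -1 := by omega
      -- the degenerate alternative for `P'`
      have hD0' : C ε * P' * (1 - C (-a) * X ^ (k' + 1) + C (-a) * X ^ (3 * (k' + 1))) =
          P'.reverse * (1 - X ^ (2 * (k' + 1)) + C (-a) * X ^ (3 * (k' + 1))) →
          intMahlerMeasure P' ≤ smythTheta := by
        intro hD
        rw [hM']
        have hdvd : P ∣ P.reverse * (1 - C (-a) * X ^ (k' + 1) + C (-a) * X ^ (3 * (k' + 1))) := by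
          refine ⟨C ε * (1 - X ^ (2 * (k' + 1)) + C (-a) * X ^ (3 * (k' + 1))), ?_⟩
          rw [hrev', hP'] at hD
          linear_combination hD - (P.reverse * (1 - C (-a) * X ^ (k' + 1) + C (-a) * X ^ (3 * (k' + 1)))) * hCε
        have hQ0 : (1 - C (-a) * X ^ (k' + 1) + C (-a) * X ^ (3 * (k' + 1)) : ℤ[X]).coeff 0 ≠ 0 := by
          simp only [coeff_add, coeff_sub, coeff_one_zero, coeff_C_mul_X_pow]
          rw [if_neg (by omega), if_neg (by omega)]; norm_num
        have h := intMahlerMeasure_le_of_dvd_reverse_mul hmonic hirr hε hε1 hne hQ0 hdvd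
        rwa [intMahlerMeasure_smythQ0a ha1' (by omega)] at h
      rcases smyth_isolation_caseB hmonic' hε' hε1 ha1' (by omega) hid2 hM1' hD0' with h | h
      · left; rw [← hM']; exact h
      · right; rw [← hM']; linarith
    · -- `b = -1` is impossible: the swapped pair would have `a_{2k} = 2`
      subst hb1
      exfalso
      have haaR : (a : ℝ) * a = 1 := by exact_mod_cast haa
      have hrel2 : (jetCoeff g (2 * k)).re =
          (jetCoeff f (2 * k)).re + ((-a : ℤ) : ℝ) * (jetCoeff f k).re + ((2 : ℤ) : ℝ) * c := by
        push_cast at hrell ⊢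
        linear_combination -hrell + (a : ℝ) * hrelk + c * haaR
      have ha1' : (-a) = 1 ∨ (-a) = -1 := by omega
      have h2 : (2 : ℤ) = 1 ∨ (2 : ℤ) = -1 :=
        smyth_b_bound hc ha1' (D.symm.abs_re_le (n := 2 * k) (by omega))
          (D.abs_re_le (n := 2 * k) (by omega)) (D.abs_re_le (n := k) hk) (by norm_num) hrel2
      omega
  · -- case `ℓ > 2k`
    obtain ⟨m, rfl⟩ : ∃ m, ℓ = 2 * k + 1 + m := ⟨ℓ - (2 * k + 1), by omega⟩
    have hid2 : C ε * P = P.reverse * (1 + C a * X ^ k) +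
        X ^ (2 * k + 1) * (C b * X ^ m + X ^ (m + 1) * R) := by
      rw [hid]; ring
    rcases smyth_isolation_caseB hmonic hε hε1 ha1 hk hid2 hM1
      (fun hD => intMahlerMeasure_le_smythTheta_of_smythD_eq_zero hmonic hirr hε hε1 hne ha1 hk hD) with h | h
    · exact Or.inl h
    · right; linarith

/-! ### The theorem -/

/-- **Smyth's theorem, isolation of `θ₀`** (Smyth 1971; [McKee–Smyth, Thm 12.1, last part]).  For an
irreducible `P ∈ ℤ[X]` with `P(0) ≠ 0` which is neither reciprocal nor antireciprocal, either
`M(P) = θ₀ = 1.3247…` or `M(P) ≥ √((93+√2249)/80) = 1.32487…`. -/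
theorem intMahlerMeasure_eq_smythTheta_or_ge {P : ℤ[X]} (hirr : Irreducible P) (h0 : P.coeff 0 ≠ 0)
    (h1 : P.reverse ≠ P) (h2 : P.reverse ≠ -P) :
    intMahlerMeasure P = smythTheta ∨ Real.sqrt ((93 + Real.sqrt 2249) / 80) ≤ intMahlerMeasure P := by
  have hP0 : P ≠ 0 := fun h => h0 (by simp [h])
  obtain ⟨-, hK2⟩ := sqrt_smyth_gap_const_bounds
  -- leading coefficient `± 1`, else `M ≥ 2`
  by_cases hlc : 2 ≤ |P.leadingCoeff|
  · right
    have h := abs_leadingCoeff_le_intMahlerMeasure P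
    have : (2 : ℝ) ≤ |(P.leadingCoeff : ℝ)| := by exact_mod_cast hlc
    linarith
  have hlc1 : |P.leadingCoeff| = 1 := by
    have hne : P.leadingCoeff ≠ 0 := leadingCoeff_ne_zero.mpr hP0
    have := Int.one_le_abs hne
    omega
  -- reduce to the monic case via `P ↦ -P`
  obtain ⟨Q, hQm, hQirr, hQM, hQ0, hQ1, hQ2⟩ : ∃ Q : ℤ[X], Q.Monic ∧ Irreducible Q ∧
      intMahlerMeasure Q = intMahlerMeasure P ∧ Q.coeff 0 ≠ 0 ∧ Q.reverse ≠ Q ∧ Q.reverse ≠ -Q := by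
    rcases (abs_eq (zero_le_one' ℤ)).mp hlc1 with h | h
    · exact ⟨P, h, hirr, rfl, h0, h1, h2⟩
    · refine ⟨-P, ?_, ?_, intMahlerMeasure_neg P, by simpa using h0, ?_, ?_⟩
      · rw [Monic, leadingCoeff_neg, h, neg_neg]
      · have e : -P = ((-1 : ℤ[X]ˣ) : ℤ[X]) * P := by simp
        rw [e]; exact (irreducible_units_mul _).mpr hirr
      · rw [reverse_neg]; intro h'; exact h1 (neg_injective h')
      · rw [reverse_neg, neg_neg]; intro h'; exact h2 (by rw [← neg_neg P.reverse, h'])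
  rw [← hQM]
  -- constant coefficient `± 1`, else `M ≥ 2`
  by_cases hc : 2 ≤ |Q.coeff 0|
  · right
    have h := abs_coeff_zero_le_intMahlerMeasure hQm
    have : (2 : ℝ) ≤ |(Q.coeff 0 : ℝ)| := by exact_mod_cast hc
    linarith
  have hc1 : |Q.coeff 0| = 1 := by
    have := Int.one_le_abs hQ0
    omega
  set ε := Q.coeff 0 with hεdef
  have hε1 : ε * ε = 1 := by
    rcases (abs_eq (zero_le_one' ℤ)).mp hc1 with h | h <;> simp [h]
  have hne : Q.reverse ≠ C ε * Q := by
    rcases (abs_eq (zero_le_one' ℤ)).mp hc1 with h | h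
    · rw [h, C_1, one_mul]; exact hQ1
    · rw [h, C_neg, C_1, neg_one_mul]; exact hQ2
  have hM1 : 1 < intMahlerMeasure Q :=
    lt_trans (by norm_num) (intMahlerMeasure_gt_of_nonreciprocal hQ0 hQ1 hQ2)
  exact smyth_isolation_of_monic hQm hQirr rfl hε1 hne hM1

/-- Decimal form: `M(P) = θ₀` or `M(P) ≥ 1.3248`. -/
theorem intMahlerMeasure_eq_smythTheta_or_ge_13248 {P : ℤ[X]} (hirr : Irreducible P) (h0 : P.coeff 0 ≠ 0)
    (h1 : P.reverse ≠ P) (h2 : P.reverse ≠ -P) :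
    intMahlerMeasure P = smythTheta ∨ (13248 : ℝ) / 10000 ≤ intMahlerMeasure P := by
  rcases intMahlerMeasure_eq_smythTheta_or_ge hirr h0 h1 h2 with h | h
  · exact Or.inl h
  · exact Or.inr (le_trans sqrt_smyth_gap_const_bounds.1.le h)

/-- **`θ₀` is isolated**: an irreducible nonreciprocal `P ∈ ℤ[X]` with `P(0) ≠ 0` and `M(P) < 1.3248` has
`M(P) = θ₀` exactly. -/
theorem intMahlerMeasure_eq_smythTheta_of_lt {P : ℤ[X]} (hirr : Irreducible P) (h0 : P.coeff 0 ≠ 0)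
    (h1 : P.reverse ≠ P) (h2 : P.reverse ≠ -P) (hlt : intMahlerMeasure P < (13248 : ℝ) / 10000) :
    intMahlerMeasure P = smythTheta := by
  rcases intMahlerMeasure_eq_smythTheta_or_ge_13248 hirr h0 h1 h2 with h | h
  · exact h
  · linarith

/-- Gap form: an irreducible nonreciprocal `P ∈ ℤ[X]` with `P(0) ≠ 0` and `M(P) ≠ θ₀` has
`M(P) ≥ √((93+√2249)/80) > θ₀ + 1.5·10⁻⁴`. -/
theorem intMahlerMeasure_ge_of_ne_smythTheta {P : ℤ[X]} (hirr : Irreducible P) (h0 : P.coeff 0 ≠ 0)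
    (h1 : P.reverse ≠ P) (h2 : P.reverse ≠ -P) (hne : intMahlerMeasure P ≠ smythTheta) :
    Real.sqrt ((93 + Real.sqrt 2249) / 80) ≤ intMahlerMeasure P :=
  (intMahlerMeasure_eq_smythTheta_or_ge hirr h0 h1 h2).resolve_left hne

end

end Summit.Ventures.DiscreteObjects.Mahler
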